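import Summits.BirchSwinnertonDyer.BirchSwinnertonDyer.Theses.TwistFamilyManinDescent
import Summits.BirchSwinnertonDyer.BirchSwinnertonDyer.Theses.ManinLocalTwoThree
import HarnessLib

/-!
# Route `ManinLocalTwoThree`, residual crux C5 `ManinPrimeToAdditiveFiveLe` (stmt-BirchSwinnertonDyer-22969), skeleton v12:
# **the two by-name Manin stubs `stub_ss57` (= stmt-27071) and `stub_ord57` (= stmt-27552) are NOT stronger than the crux — each is a
# special case of C5 itself**

Lead seat bsd-line-ml23-c5-p1 (gen 6); a no-over-claim certificate for the refuters. Of the five stubs of skeleton v12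
(`Cruxes/ManinPrimeToAdditiveFiveLe/Lines/upper_anchor.lean`, sha16 bd42322545d00406) two are Manin statements owned by route
`TwistFamilyManinDescent` — K15b `SupersingularUnstarredStrongManinUnit` (stmt-27071) and `OrdinaryCornerManinResidual` (stmt-27552) — and
both FOLLOW from C5 (they quantify over lattice-optimal data at a level `N` with `p² ∣ N`, `p ∈ {5, 7}`, plus row / reducibility /
twist-additivity binders that C5 does not need). So on these two stubs the skeleton loses nothing: a refutation of either one refutes C5.
The remaining two stubs (E-imc-5 at 5, 7; E-imc-9 at 13) are Manin-free laws NOT implied by C5 — the line's declared price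
(critic-10 VERDICT #1 PASS-WITH-PRICE). Pure logic; nothing here proves C5, the items, Manin's conjecture or BSD.

References: [EdixhovenManin1991] Thm. 3; route TwistFamilyManinDescent (bsd-idea-3) items 27071, 27552.
-/

set_option autoImplicit false
-- the Theorems namespace of this sub repeats the summit name by design (D-0017 nested layout)
set_option linter.dupNamespace false

noncomputable section

namespace Summit.BirchSwinnertonDyer.BirchSwinnertonDyer.Theorems

/-- **C5 ⟹ K15b (stmt-27071).** The row, reducibility and twist-additivity binders of K15b are idle. [cite: EdixhovenManin1991, Thm. 3] -/
theorem supersingularUnstarredStrongManinUnit_of_maninPrimeToAdditiveFiveLe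
    (hC5 : Summit.BirchSwinnertonDyer.BirchSwinnertonDyer.Theses.ManinLocalTwoThree.ManinPrimeToAdditiveFiveLe) :
    Summit.BirchSwinnertonDyer.BirchSwinnertonDyer.Theses.TwistFamilyManinDescent.SupersingularUnstarredStrongManinUnit := by
  intro hM hAU hC hnf W _ _ N _ D p hp hrow hpN _hred _htw hD
  have h5 : 5 ≤ p := by
    rcases hrow with ⟨rfl, -⟩ | ⟨rfl, -⟩ <;> norm_num
  exact hC5 hM hAU hC hnf W D hD p hp h5 hpN

/-- **C5 ⟹ `OrdinaryCornerManinResidual` (stmt-27552).** The row exclusions, reducibility and twist-additivity binders are idle.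
[cite: EdixhovenManin1991, Thm. 3] -/
theorem ordinaryCornerManinResidual_of_maninPrimeToAdditiveFiveLe
    (hC5 : Summit.BirchSwinnertonDyer.BirchSwinnertonDyer.Theses.ManinLocalTwoThree.ManinPrimeToAdditiveFiveLe) :
    Summit.BirchSwinnertonDyer.BirchSwinnertonDyer.Theses.TwistFamilyManinDescent.OrdinaryCornerManinResidual := by
  intro hM hAU hC hnf W _ _ N _ D p hp h57 _hss _hII hpN _hred _htw hD
  have h5 : 5 ≤ p := by
    rcases h57 with rfl | rfl <;> norm_num
  exact hC5 hM hAU hC hnf W D hD p hp h5 hpN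

end Summit.BirchSwinnertonDyer.BirchSwinnertonDyer.Theorems

end
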